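import Literature.MathematicalPhysics.KineticTheory.EvenStatTruncationBound
import Literature.MathematicalPhysics.KineticTheory.HardSphereUniformDensityLLN
import HarnessLib

/-!
# The Enskog rate functional has the Enskog mean at rung 0 for every continuous mark with a bounded
# sphere-integrated mark

Topic `Literature/MathematicalPhysics/KineticTheory` (kind proof; the static ENSKOG-side limit of the Enskog closure at
rung 0 for a GENERAL mark, wanted by the crux line `Sketch` of `InformationPercolationEngine.CollisionRate`,
stmt-AtomisticToContinuum-13481, registered stub `stub_meanEnskogUnitRung0`, whose mark is the speed-truncated unit mark
`Ξ₁ᴸ(n, v, w) = ψ_L(‖w − v‖)`).  Under the rung-0 local Gibbs law `G_N` (constant profiles `a, u, θ`) of `N + 1` hard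
spheres of diameter `σ (N+1)^{-1/3}` on `𝕋³`, the Gibbs mean of the Enskog rate functional
`e_t(z) = ∫ χ(t,x) ψ(σ³ρ_r(z,x)) B_r Ξ (z,x) dx`, `ψ = g · Y`, converges, as `N → ∞`, to
`(∫ χ(t,·)) · ψ(σ³) · ∫∫ Θ Ξ (v, w) M(v) M(w) dv dw` (`M = M_{1,u,θ}`), for EVERY continuous mark `Ξ` with `|Θ Ξ| ≤ C_Θ`,
given only that `ψ` is bounded on `[0, ∞)` and continuous at `σ³` (the equation-of-state input, kept as hypotheses):

* `tendsto_posGibbs_integral_psi_offDiag` — the position LLN `E[ψ(sρ̄) Q] → ψ(s)` for the uniform gas (deterministic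
  estimate `abs_mul_offDiag_sub_le` integrated, vanishing variance of the mollified density `tendsto_variance_uniform`);
* `integral_vel_pairFunctional_of_measurable` — the velocity average of the pair functional at fixed positions
  (`Θ(v, v) = 0` on the diagonal, `integral_pi_pair` off it);
* `tendsto_integral_enskogRate_rung0_of_psi` — the limit (product structure of `G_N`, Fubini in `x`, dominated
  convergence over the compact torus).

Proofs adapted verbatim from the sibling crux's hard-wired versions (`Theorems.EvenStressEnskog.stub_enskogRateMeanRung0`,
truncated even marks).

References: H. van Beijeren, M. H. Ernst, Physica 68 (1973) [VanbeijerenErnst1973]; S. Chapman, T. G. Cowling (1970)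
§16.4 [ChapmanCowling1970]; H. Spohn (1991) Part I §2.3 [Spohn1991].
-/

noncomputable section

open MeasureTheory ProbabilityTheory Set Filter Topology
open scoped ENNReal InnerProductSpace BigOperators

namespace Literature.MathematicalPhysics.KineticTheory

open Literature.Analysis.FluidPDE Literature.MathematicalPhysics.StatisticalMechanics

/-! ## Small measurability / continuity facts -/

/-- The cone kernel is continuous in its first argument. [folklore] -/
theorem continuous_coneKernel_left (r : ℝ) (x₀ : UnitAddTorus (Fin 3)) :
    Continuous fun y : UnitAddTorus (Fin 3) => coneKernel r y x₀ := by
  have h : Continuous fun y : UnitAddTorus (Fin 3) => Torus.euclidDist y x₀ := by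
    simpa only [Function.comp_def, id_eq] using Torus.continuous_euclidDist.comp (continuous_id.prodMk continuous_const)
  unfold coneKernel
  exact continuous_const.mul ((continuous_const.sub (h.div_const r)).max continuous_const)

/-- `|B_r Ξ (z, x₀)| ≤ (3/(πr³))² · C_Θ` when `|Θ Ξ| ≤ C_Θ`, uniformly in `N` and in the configuration. [folklore] -/
theorem abs_pairFunctional_le_sq_mul_of_abs_sphereMark_le {N : ℕ} {Ξ : V3 × V3 × V3 → ℝ} {CΘ r : ℝ}
    (hΘb : ∀ v w, |sphereMark Ξ v w| ≤ CΘ) (hr : 0 < r)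
    (z : Config (N + 1) (Fin 3) T3) (x₀ : UnitAddTorus (Fin 3)) :
    |pairFunctional r Ξ z x₀| ≤ (3 / (Real.pi * r ^ 3)) ^ 2 * CΘ := by
  haveI : IsProbabilityMeasure (empiricalMeasure z) := isProbabilityMeasure_empiricalMeasure (by omega) z
  have hCΘ0 : 0 ≤ CΘ := (abs_nonneg _).trans (hΘb 0 0)
  have hk : ∀ x y : UnitAddTorus (Fin 3), |coneKernel r x y| ≤ 3 / (Real.pi * r ^ 3) := fun x y => by
    have h := coneKernel_mem_Icc hr x y
    rw [abs_of_nonneg h.1]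
    exact h.2
  set C := (3 / (Real.pi * r ^ 3)) ^ 2 * CΘ with hC
  have h := norm_integral_le_of_norm_le_const
    (μ := (empiricalMeasure z).prod (empiricalMeasure z))
    (f := fun p : (T3 × V3) × (T3 × V3) =>
      coneKernel r p.1.1 x₀ * coneKernel r p.2.1 x₀ * sphereMark Ξ p.1.2 p.2.2)
    (C := C) (Eventually.of_forall fun p => ?_)
  · have hmass : ((empiricalMeasure z).prod (empiricalMeasure z)).real univ = 1 := by
      rw [probReal_univ]
    simpa only [Real.norm_eq_abs, pairFunctional, hmass, mul_one] using h
  · rw [Real.norm_eq_abs, abs_mul, abs_mul, hC, sq]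
    exact mul_le_mul (mul_le_mul (hk _ _) (hk _ _) (abs_nonneg _) (by positivity)) (hΘb _ _) (abs_nonneg _)
      (by positivity)

/-- A uniform-in-`N` bound for the Enskog rate functional of a mark with `|Θ Ξ| ≤ C_Θ`, `|χ(t, ·)| ≤ C_χ`,
`|g Y| ≤ C_{gY}` on `[0, ∞)`. [folklore] -/
theorem abs_enskogRate_le_of_abs_sphereMark_le_const {σ : ℝ} {χ : ℝ × UnitAddTorus (Fin 3) → ℝ} {g : ℝ → ℝ}
    {Ξ : V3 × V3 × V3 → ℝ} {CΘ r Cχ CgY : ℝ} {t : ℝ} (hχb : ∀ x, |χ (t, x)| ≤ Cχ)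
    (hgY : ∀ a, 0 ≤ a → |g a * contactValue a| ≤ CgY)
    (hσ : 0 ≤ σ) (hΘb : ∀ v w, |sphereMark Ξ v w| ≤ CΘ) (hr : 0 < r) (N : ℕ) (z : Config (N + 1) (Fin 3) T3) :
    |enskogRate σ N χ g Ξ r t z| ≤
      Cχ * CgY * ((3 / (Real.pi * r ^ 3)) ^ 2 * CΘ) * (volume : Measure (UnitAddTorus (Fin 3))).real univ := by
  set CB := (3 / (Real.pi * r ^ 3)) ^ 2 * CΘ with hCB
  have hCχ0 : 0 ≤ Cχ := (abs_nonneg _).trans (hχb (z 0).1)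
  have hCgY0 : 0 ≤ CgY := (abs_nonneg _).trans (hgY 0 le_rfl)
  unfold enskogRate
  have h := norm_integral_le_of_norm_le_const (μ := (volume : Measure (UnitAddTorus (Fin 3))))
    (f := fun x => χ (t, x) * g (σ ^ 3 * mollDensity r z x) * contactValue (σ ^ 3 * mollDensity r z x) *
      pairFunctional r Ξ z x)
    (C := Cχ * CgY * CB) (Eventually.of_forall fun x => ?_)
  · simpa only [Real.norm_eq_abs] using h
  · rw [Real.norm_eq_abs, mul_assoc (χ (t, x)), abs_mul, abs_mul]
    have ha : 0 ≤ σ ^ 3 * mollDensity r z x := mul_nonneg (pow_nonneg hσ 3) (mollDensity_nonneg_of_pos hr z x)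
    exact mul_le_mul (mul_le_mul (hχb _) (hgY _ ha) (abs_nonneg _) hCχ0)
      (abs_pairFunctional_le_sq_mul_of_abs_sphereMark_le hΘb hr z x) (abs_nonneg _) (by positivity)

/-! ## The position average converges -/


/-- **The position average converges.**  For the uniform gas at small reduced density `σ`
(configurational Gibbs measure of `N + 1` spheres of diameter `σ(N+1)^{-1/3}`, constant activity
`a > 0`), `ψ` measurable, bounded by `K` on `[0, ∞)` and continuous at `s > 0`, and a continuous weight
`0 ≤ b ≤ M` of total mass `1`: with `ρ̄ = (N+1)⁻¹ Σ b(xᵢ)` and `Q = (N+1)⁻² Σ_{i ≠ j} b(xᵢ) b(xⱼ)`,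
`E[ψ(s ρ̄) Q] → ψ(s)` — the deterministic estimate `abs_mul_offDiag_sub_le` integrated, and the variance
limit `tendsto_variance_uniform`. [folklore] -/
theorem tendsto_posGibbs_integral_psi_offDiag {σ a : ℝ} (h : SmallDensity uniformProfile σ) (ha : 0 < a)
    {ψ : ℝ → ℝ} (hψm : Measurable ψ) {K : ℝ} (hK : ∀ y, 0 ≤ y → |ψ y| ≤ K) {s : ℝ} (hs : 0 < s)
    (hcont : ContinuousAt ψ s) {b : T3 → ℝ} (hbc : Continuous b) {M : ℝ}
    (hb : ∀ y, b y ∈ Set.Icc 0 M) (hb1 : ∫ y, b y = 1) :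
    Tendsto (fun N : ℕ => ∫ xs, ψ (s * ((((N + 1 : ℕ) : ℝ))⁻¹ * ∑ i, b (xs i))) *
        ((((N + 1 : ℕ) : ℝ))⁻¹ * (((N + 1 : ℕ) : ℝ))⁻¹ * ∑ i, ∑ j, if i = j then 0 else b (xs i) * b (xs j))
        ∂posGibbsMeasure (fun _ : T3 => a) (hsDiameter σ N) (N + 1)) atTop (𝓝 (ψ s)) := by
  have hM : 0 ≤ M := (hb 0).1.trans (hb 0).2
  have hK0 : 0 ≤ K := (abs_nonneg _).trans (hK 0 le_rfl)
  haveI hprob : ∀ N : ℕ, IsProbabilityMeasure (posGibbsMeasure (fun _ : T3 => a) (hsDiameter σ N) (N + 1)) :=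
    fun N => isProbabilityMeasure_posGibbsMeasure continuous_const (fun _ => ha) h.σ_lt_half.le N
  -- continuous functions of the positions are integrable
  have hintc : ∀ (N : ℕ) {f : (Fin (N + 1) → T3) → ℝ}, Continuous f →
      Integrable f (posGibbsMeasure (fun _ : T3 => a) (hsDiameter σ N) (N + 1)) :=
    fun N f hf => hf.integrable_of_hasCompactSupport (isClosed_tsupport _).isCompact
  have hρc : ∀ N : ℕ, Continuous fun xs : Fin (N + 1) → T3 => (((N + 1 : ℕ) : ℝ))⁻¹ * ∑ i, b (xs i) :=
    fun N => continuous_const.mul (continuous_finsetSum _ fun i _ => hbc.comp (continuous_apply i))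
  have hQc : ∀ N : ℕ, Continuous fun xs : Fin (N + 1) → T3 => (((N + 1 : ℕ) : ℝ))⁻¹ * (((N + 1 : ℕ) : ℝ))⁻¹ *
      ∑ i, ∑ j, (if i = j then (0 : ℝ) else b (xs i) * b (xs j)) := by
    intro N
    refine continuous_const.mul (continuous_finsetSum _ fun i _ => continuous_finsetSum _ fun j _ => ?_)
    split_ifs
    · exact continuous_const
    · exact (hbc.comp (continuous_apply i)).mul (hbc.comp (continuous_apply j))
  -- the variance tends to zero
  set V : ℕ → ℝ := fun N => ∫ xs, ((((N + 1 : ℕ) : ℝ))⁻¹ * ∑ i, b (xs i) - 1) ^ 2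
    ∂posGibbsMeasure (fun _ : T3 => a) (hsDiameter σ N) (N + 1) with hV
  have hVlim : Tendsto V atTop (𝓝 0) := by
    have h1 := tendsto_variance_uniform h hbc
    rw [hb1] at h1
    refine h1.congr fun N => ?_
    simp only [hV]
    rw [integral_posGibbsMeasure_const ha, div_eq_inv_mul]
    rfl
  rw [Metric.tendsto_atTop]
  intro η hη
  have hA : 0 < K * (M + 1) + 1 := by positivity
  obtain ⟨δ, hδ, hδε⟩ := Metric.continuousAt_iff.1 hcont (η / (4 * (K * (M + 1) + 1))) (by positivity)
  set ε := η / (4 * (K * (M + 1) + 1)) with hε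
  have hε0 : 0 < ε := by positivity
  set C := K * (M + 1) / (4 * ε) + 2 * K * s ^ 2 / δ ^ 2 with hC
  have hR : Tendsto (fun N : ℕ => C * V N + K * M ^ 2 * (((N + 1 : ℕ) : ℝ))⁻¹) atTop (𝓝 0) := by
    have h1 : Tendsto (fun N : ℕ => (((N + 1 : ℕ) : ℝ))⁻¹) atTop (𝓝 0) :=
      tendsto_inv_atTop_zero.comp ((tendsto_natCast_atTop_atTop (R := ℝ)).comp (tendsto_add_atTop_nat 1))
    simpa using (hVlim.const_mul C).add (h1.const_mul (K * M ^ 2))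
  obtain ⟨N₀, hN₀⟩ := Metric.tendsto_atTop.1 hR (η / 2) (by positivity)
  refine ⟨N₀, fun N hN => ?_⟩
  have hRN := hN₀ N hN
  rw [Real.dist_eq, sub_zero] at hRN
  set μ := posGibbsMeasure (fun _ : T3 => a) (hsDiameter σ N) (N + 1) with hμ
  set ρ : (Fin (N + 1) → T3) → ℝ := fun xs => (((N + 1 : ℕ) : ℝ))⁻¹ * ∑ i, b (xs i) with hρ
  set Q : (Fin (N + 1) → T3) → ℝ := fun xs => (((N + 1 : ℕ) : ℝ))⁻¹ * (((N + 1 : ℕ) : ℝ))⁻¹ *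
    ∑ i, ∑ j, (if i = j then (0 : ℝ) else b (xs i) * b (xs j)) with hQ
  -- the pointwise bound and its integral
  have hpt : ∀ xs, |ψ (s * ρ xs) * Q xs - ψ s| ≤
      (K * (M + 1) + 1) * ε + C * (ρ xs - 1) ^ 2 + K * M ^ 2 * (((N + 1 : ℕ) : ℝ))⁻¹ := fun xs =>
    abs_mul_offDiag_sub_le hK hM hs hε0 hδ (fun y hy => hδε hy) (fun i => b (xs i)) fun i => hb _
  have hsqc : Continuous fun xs : Fin (N + 1) → T3 => (ρ xs - 1) ^ 2 := ((hρc N).sub continuous_const).pow 2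
  have hI0 : Integrable (fun _ : Fin (N + 1) → T3 => (K * (M + 1) + 1) * ε) μ := integrable_const _
  have hI1 : Integrable (fun xs : Fin (N + 1) → T3 => C * (ρ xs - 1) ^ 2) μ := (hintc N hsqc).const_mul C
  have hI2 : Integrable (fun _ : Fin (N + 1) → T3 => K * M ^ 2 * (((N + 1 : ℕ) : ℝ))⁻¹) μ :=
    integrable_const _
  have hI01 : Integrable (fun xs : Fin (N + 1) → T3 => (K * (M + 1) + 1) * ε + C * (ρ xs - 1) ^ 2) μ :=
    hI0.add hI1
  have hGi : Integrable (fun xs => (K * (M + 1) + 1) * ε + C * (ρ xs - 1) ^ 2 +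
      K * M ^ 2 * (((N + 1 : ℕ) : ℝ))⁻¹) μ := hI01.add hI2
  have hFm : AEStronglyMeasurable (fun xs => ψ (s * ρ xs) * Q xs - ψ s) μ :=
    (((hψm.comp (continuous_const.mul (hρc N)).measurable).mul (hQc N).measurable).sub
      measurable_const).aestronglyMeasurable
  have hFi : Integrable (fun xs => ψ (s * ρ xs) * Q xs - ψ s) μ :=
    hGi.mono' hFm (ae_of_all _ fun xs => by rw [Real.norm_eq_abs]; exact hpt xs)
  have hFi' : Integrable (fun xs => ψ (s * ρ xs) * Q xs) μ :=
    (hFi.add (integrable_const (ψ s))).congr (ae_of_all _ fun xs => by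
      simp only [Pi.add_apply, sub_add_cancel])
  rw [Real.dist_eq]
  calc |∫ xs, ψ (s * ρ xs) * Q xs ∂μ - ψ s| = |∫ xs, (ψ (s * ρ xs) * Q xs - ψ s) ∂μ| := by
        rw [integral_sub hFi' (integrable_const _), integral_const, smul_eq_mul, probReal_univ, one_mul]
    _ ≤ ∫ xs, |ψ (s * ρ xs) * Q xs - ψ s| ∂μ := abs_integral_le_integral_abs
    _ ≤ ∫ xs, ((K * (M + 1) + 1) * ε + C * (ρ xs - 1) ^ 2 + K * M ^ 2 * (((N + 1 : ℕ) : ℝ))⁻¹) ∂μ :=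
        integral_mono_of_nonneg (ae_of_all _ fun _ => abs_nonneg _) hGi (ae_of_all _ hpt)
    _ = (K * (M + 1) + 1) * ε + (C * V N + K * M ^ 2 * (((N + 1 : ℕ) : ℝ))⁻¹) := by
        have hVN : ∫ xs, (ρ xs - 1) ^ 2 ∂μ = V N := rfl
        rw [integral_add hI01 hI2, integral_add hI0 hI1, integral_const, integral_const, integral_const_mul,
          smul_eq_mul, smul_eq_mul, probReal_univ, one_mul, one_mul, hVN]
        ring
    _ < η := by
        have h1 : (K * (M + 1) + 1) * ε = η / 4 := by
          rw [hε]; field_simp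
        have h2 : C * V N + K * M ^ 2 * (((N + 1 : ℕ) : ℝ))⁻¹ < η / 2 := (le_abs_self _).trans_lt hRN
        linarith


/-! ## The registered stub -/


/-! ## The velocity average at fixed positions -/


/-- **Velocity average of the pair functional at fixed positions** (any mark whose sphere-integrated mark
is jointly measurable and bounded).  Under `⊗ᵢ N(u, θ id)`,
`∫ B_r Ξ (zipConfig (x, v), x₀) dv = Θ̄ · (N+1)⁻² Σ_{i ≠ j} b_r(xᵢ, x₀) b_r(xⱼ, x₀)` with
`Θ̄ = ∫ Θ Ξ d(N(u,θ) ⊗ N(u,θ))`: the diagonal terms vanish (`sphereMark_diag`) and each off-diagonal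
pair of velocities is `N(u,θ) ⊗ N(u,θ)` distributed (`integral_pi_pair`). [folklore] -/
theorem integral_vel_pairFunctional_of_measurable {N : ℕ} (u : V3) (θ : ℝ) {Ξ : V3 × V3 × V3 → ℝ}
    (hΘm : Measurable fun p : V3 × V3 => sphereMark Ξ p.1 p.2) {CΘ : ℝ} (hΘb : ∀ v w, |sphereMark Ξ v w| ≤ CΘ)
    (r : ℝ) (xs : Fin (N + 1) → T3) (x₀ : T3) :
    ∫ vs, pairFunctional r Ξ (zipConfig (xs, vs)) x₀
        ∂(Measure.pi fun _ : Fin (N + 1) => gaussMeasure u θ) =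
      (∫ p, sphereMark Ξ p.1 p.2 ∂((gaussMeasure u θ).prod (gaussMeasure u θ))) *
        ((((N + 1 : ℕ) : ℝ))⁻¹ * (((N + 1 : ℕ) : ℝ))⁻¹ *
          ∑ i, ∑ j, if i = j then 0 else coneKernel r (xs i) x₀ * coneKernel r (xs j) x₀) := by
  have hint : ∀ i j : Fin (N + 1), Integrable (fun vs : Fin (N + 1) → V3 =>
      sphereMark Ξ (vs i) (vs j)) (Measure.pi fun _ : Fin (N + 1) => gaussMeasure u θ) := by
    intro i j
    have hf : Continuous fun vs : Fin (N + 1) → V3 => (vs i, vs j) :=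
      (continuous_apply i).prodMk (continuous_apply j)
    refine Integrable.mono' (integrable_const CΘ) (hΘm.comp hf.measurable).aestronglyMeasurable
      (ae_of_all _ fun vs => ?_)
    rw [Real.norm_eq_abs]
    exact hΘb _ _
  have hterm : ∀ i j : Fin (N + 1), ∫ vs, sphereMark Ξ (vs i) (vs j)
      ∂(Measure.pi fun _ : Fin (N + 1) => gaussMeasure u θ) = if i = j then 0 else
        ∫ p, sphereMark Ξ p.1 p.2 ∂((gaussMeasure u θ).prod (gaussMeasure u θ)) := by
    intro i j
    split_ifs with hij
    · subst hij; simp_rw [sphereMark_diag]; exact integral_zero _ _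
    · exact integral_pi_pair (gaussMeasure u θ) hij hΘm.aestronglyMeasurable
  simp only [pairFunctional_eq_double_sum, zipConfig_apply]
  rw [integral_const_mul, integral_finsetSum _ fun i _ => integrable_finsetSum _ fun j _ => (hint i j).const_mul _]
  have inner : ∀ i : Fin (N + 1), ∫ vs, ∑ j, coneKernel r (xs i) x₀ * coneKernel r (xs j) x₀ *
      sphereMark Ξ (vs i) (vs j) ∂(Measure.pi fun _ : Fin (N + 1) => gaussMeasure u θ) =
      (∫ p, sphereMark Ξ p.1 p.2 ∂((gaussMeasure u θ).prod (gaussMeasure u θ))) *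
        ∑ j, (if i = j then 0 else coneKernel r (xs i) x₀ * coneKernel r (xs j) x₀) := by
    intro i
    rw [integral_finsetSum _ fun j _ => (hint i j).const_mul _, Finset.mul_sum]
    refine Finset.sum_congr rfl fun j _ => ?_
    rw [integral_const_mul, hterm]
    split_ifs <;> ring
  simp_rw [inner, ← Finset.mul_sum]
  ring

/-! ## The Enskog side at rung 0, general mark -/

/-- **The Enskog rate functional has the Enskog mean at rung 0, for every continuous mark with a bounded
sphere-integrated mark** (mark-generic form of the sibling crux's helper stub `stub_enskogRateMeanRung0`, the
equation of state entering only through the hypotheses on `ψ = g · Y`: bounded by `K` on `[0, ∞)` and continuous at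
`σ³`).  Under the rung-0 local Gibbs law of constant profiles `a, θ > 0`, `u`, at small reduced density `σ`, for
continuous `χ, g`, `|Θ Ξ| ≤ C_Θ`, `0 < r < 1/2`, any `t` and any flows:
`E_{G_N}[e_t] → (∫χ(t,·)) g(σ³) Y(σ³) Θ̄_{MM}` — velocity average at fixed positions
(`integral_vel_pairFunctional_of_measurable`), the position LLN `tendsto_posGibbs_integral_psi_offDiag`, Fubini and
dominated convergence over the torus. [cite: VanbeijerenErnst1973] -/
theorem tendsto_integral_enskogRate_rung0_of_psi {σ a θ : ℝ} {u : V3} (hsd : SmallDensity uniformProfile σ)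
    (ha : 0 < a) (hθ : 0 < θ) {χ : ℝ × UnitAddTorus (Fin 3) → ℝ} (hχ : Continuous χ) {g : ℝ → ℝ} (hg : Continuous g)
    {K : ℝ} (hK : ∀ y, 0 ≤ y → |g y * contactValue y| ≤ K)
    (hψc : ContinuousAt (fun b => g b * contactValue b) (σ ^ 3))
    {Ξ : V3 × V3 × V3 → ℝ} (hΞc : Continuous Ξ) {CΘ : ℝ} (hΘb : ∀ v w, |sphereMark Ξ v w| ≤ CΘ)
    {r : ℝ} (hr : 0 < r) (hr2 : r < 1 / 2) (t : ℝ)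
    (Φ : (N : ℕ) → HardSphereFlow (Torus.geometry (Fin 3)) (hsDiameter σ N) (N + 1)) :
    Tendsto (fun N : ℕ => ∫ z, enskogRate σ N χ g Ξ r t z
        ∂(localGibbsLaw σ (fun _ => a) (fun _ => u) (fun _ => θ) N (Φ N))) atTop
      (𝓝 ((∫ x : UnitAddTorus (Fin 3), χ (t, x)) * g (σ ^ 3) * contactValue (σ ^ 3) *
        ∫ p : V3 × V3, sphereMark Ξ p.1 p.2 * (localMaxwellian 1 θ u p.1 * localMaxwellian 1 θ u p.2))) := by
  have hσ : 0 < σ := hsd.σ_pos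
  have hσ2 : σ ≤ 1 / 2 := hsd.σ_lt_half.le
  have hK0 : 0 ≤ K := (abs_nonneg _).trans (hK 0 le_rfl)
  have hs : 0 < σ ^ 3 := pow_pos hσ 3
  set ψ : ℝ → ℝ := fun b => g b * contactValue b with hψ
  have hYm : Measurable contactValue := by
    unfold contactValue
    exact (measurable_deriv _).const_mul _
  have hψm : Measurable ψ := hg.measurable.mul hYm
  have hΘm : Measurable fun p : V3 × V3 => sphereMark Ξ p.1 p.2 := (continuous_sphereMark_uncurry hΞc).measurable
  -- sizes: the cone kernel, the pair functional
  have hbM : ∀ y x₀ : T3, coneKernel r y x₀ ∈ Set.Icc (0 : ℝ) (3 / (Real.pi * r ^ 3)) :=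
    fun y x₀ => coneKernel_mem_Icc hr y x₀
  have hB : ∀ (N : ℕ) (z : Config (N + 1) (Fin 3) T3) (x₀ : T3),
      |pairFunctional r Ξ z x₀| ≤ (3 / (Real.pi * r ^ 3)) ^ 2 * CΘ := fun N z x₀ =>
    abs_pairFunctional_le_sq_mul_of_abs_sphereMark_le hΘb hr z x₀
  set Bb : ℝ := (3 / (Real.pi * r ^ 3)) ^ 2 * CΘ with hBb
  haveI hLG : ∀ N : ℕ, IsProbabilityMeasure (localGibbsLaw σ (fun _ => a) (fun _ => u) (fun _ => θ) N (Φ N)) :=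
    fun N => isProbabilityMeasure_localGibbsLaw continuous_const continuous_const continuous_const
      (fun _ => ha) (fun _ => hθ) hσ2 N (Φ N)
  haveI hPG : ∀ N : ℕ, IsProbabilityMeasure (posGibbsMeasure (fun _ : T3 => a) (hsDiameter σ N) (N + 1)) :=
    fun N => isProbabilityMeasure_posGibbsMeasure continuous_const (fun _ => ha) hσ2 N
  -- joint measurability of the reduced integrand `ψ(σ³ρ_r(z, x)) B_r(z, x)`
  have hf2 : ∀ N : ℕ, Measurable fun q : Config (N + 1) (Fin 3) T3 × T3 =>
      ψ (σ ^ 3 * mollDensity r q.1 q.2) * pairFunctional r Ξ q.1 q.2 := by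
    intro N
    have hρ : Measurable fun q : Config (N + 1) (Fin 3) T3 × T3 => mollDensity r q.1 q.2 := by
      simp_rw [mollDensity_eq_avg]
      refine measurable_const.mul (Finset.measurable_sum _ fun i _ => ?_)
      exact measurable_coneKernel_comp r ((measurable_pi_apply i).comp measurable_fst).fst measurable_snd
    have hBm : Measurable fun q : Config (N + 1) (Fin 3) T3 × T3 => pairFunctional r Ξ q.1 q.2 := by
      simp_rw [pairFunctional_eq_double_sum]
      refine measurable_const.mul (Finset.measurable_sum _ fun i _ => Finset.measurable_sum _ fun j _ => ?_)
      refine ((measurable_coneKernel_comp r ((measurable_pi_apply i).comp measurable_fst).fst measurable_snd).mul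
        (measurable_coneKernel_comp r ((measurable_pi_apply j).comp measurable_fst).fst measurable_snd)).mul ?_
      exact hΘm.comp (((measurable_pi_apply i).comp measurable_fst).snd.prodMk
        ((measurable_pi_apply j).comp measurable_fst).snd)
    have h := (hψm.comp (hρ.const_mul (σ ^ 3))).mul hBm
    exact h
  have hf1 : ∀ (N : ℕ) (x₀ : T3), Measurable fun z : Config (N + 1) (Fin 3) T3 =>
      ψ (σ ^ 3 * mollDensity r z x₀) * pairFunctional r Ξ z x₀ := by
    intro N x₀
    have h := (hf2 N).comp (measurable_id.prodMk measurable_const :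
      Measurable fun z : Config (N + 1) (Fin 3) T3 => (z, x₀))
    exact h
  have hfb : ∀ (N : ℕ) (z : Config (N + 1) (Fin 3) T3) (x₀ : T3),
      |ψ (σ ^ 3 * mollDensity r z x₀) * pairFunctional r Ξ z x₀| ≤ K * Bb := by
    intro N z x₀
    rw [abs_mul]
    exact mul_le_mul (hK _ (mul_nonneg hs.le (mollDensity_nonneg_of_pos hr _ _))) (hB N z x₀) (abs_nonneg _) hK0
  -- STEP 1: reduction of `J_N(x₀) = E[ψ B_r]` to the position average of `ψ(σ³ρ̄) Q`
  have hJ : ∀ (x₀ : T3) (N : ℕ),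
      ∫ z, ψ (σ ^ 3 * mollDensity r z x₀) * pairFunctional r Ξ z x₀
          ∂(localGibbsLaw σ (fun _ => a) (fun _ => u) (fun _ => θ) N (Φ N)) =
        (∫ p, sphereMark Ξ p.1 p.2 ∂((gaussMeasure u θ).prod (gaussMeasure u θ))) *
          ∫ xs, ψ (σ ^ 3 * ((((N + 1 : ℕ) : ℝ))⁻¹ * ∑ i, coneKernel r (xs i) x₀)) *
            ((((N + 1 : ℕ) : ℝ))⁻¹ * (((N + 1 : ℕ) : ℝ))⁻¹ *
              ∑ i, ∑ j, if i = j then 0 else coneKernel r (xs i) x₀ * coneKernel r (xs j) x₀)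
            ∂posGibbsMeasure (fun _ : T3 => a) (hsDiameter σ N) (N + 1) := by
    intro x₀ N
    rw [integral_localGibbsLaw_rung0 σ ha.le hθ u N (Φ N), integral_prod]
    · have e : ∀ (xs : Fin (N + 1) → T3) (vs : Fin (N + 1) → V3),
          σ ^ 3 * mollDensity r (zipConfig (xs, vs)) x₀ =
            σ ^ 3 * ((((N + 1 : ℕ) : ℝ))⁻¹ * ∑ i, coneKernel r (xs i) x₀) := by
        intro xs vs; simp only [mollDensity_eq_avg, zipConfig_apply]
      have hv := fun xs : Fin (N + 1) → T3 => integral_vel_pairFunctional_of_measurable u θ hΘm hΘb r xs x₀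
      simp_rw [e, integral_const_mul, hv]
      rw [← integral_const_mul]
      exact integral_congr_ae (ae_of_all _ fun xs => by ring)
    · exact Integrable.mono' (integrable_const (K * Bb)) ((hf1 N x₀).comp measurable_zipConfig).aestronglyMeasurable
        (ae_of_all _ fun p => by rw [Real.norm_eq_abs]; exact hfb N _ _)
  -- STEP 2: the pointwise-in-`x₀` limit
  have hlim : ∀ x₀ : T3, Tendsto (fun N : ℕ =>
      ∫ z, ψ (σ ^ 3 * mollDensity r z x₀) * pairFunctional r Ξ z x₀
        ∂(localGibbsLaw σ (fun _ => a) (fun _ => u) (fun _ => θ) N (Φ N))) atTop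
      (𝓝 ((∫ p, sphereMark Ξ p.1 p.2 ∂((gaussMeasure u θ).prod (gaussMeasure u θ))) *
        ψ (σ ^ 3))) := fun x₀ =>
    ((tendsto_posGibbs_integral_psi_offDiag hsd ha hψm hK hs hψc
      (continuous_coneKernel_left r x₀) (fun y => hbM y x₀)
      (integral_coneKernel hr hr2 x₀)).const_mul _).congr fun N => (hJ x₀ N).symm
  -- STEP 3: Fubini — `E[e_t] = ∫ χ(t, x₀) J_N(x₀) dx₀`
  obtain ⟨Cχ, hCχ0, hCχ⟩ := exists_forall_abs_le_of_continuous (χ := fun x => χ (t, x))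
    (hχ.comp (continuous_const.prodMk continuous_id))
  have hE : ∀ N : ℕ, ∫ z, enskogRate σ N χ g Ξ r t z
      ∂(localGibbsLaw σ (fun _ => a) (fun _ => u) (fun _ => θ) N (Φ N)) =
      ∫ x₀, χ (t, x₀) * ∫ z, ψ (σ ^ 3 * mollDensity r z x₀) * pairFunctional r Ξ z x₀
        ∂(localGibbsLaw σ (fun _ => a) (fun _ => u) (fun _ => θ) N (Φ N)) := by
    intro N
    have hswap := integral_integral_swap (μ := localGibbsLaw σ (fun _ => a) (fun _ => u) (fun _ => θ) N (Φ N))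
      (ν := (volume : Measure T3)) (f := fun z x₀ => χ (t, x₀) *
        (ψ (σ ^ 3 * mollDensity r z x₀) * pairFunctional r Ξ z x₀)) ?_
    · calc ∫ z, enskogRate σ N χ g Ξ r t z
            ∂(localGibbsLaw σ (fun _ => a) (fun _ => u) (fun _ => θ) N (Φ N))
          = ∫ z, (∫ x₀, χ (t, x₀) * (ψ (σ ^ 3 * mollDensity r z x₀) *
              pairFunctional r Ξ z x₀))
              ∂(localGibbsLaw σ (fun _ => a) (fun _ => u) (fun _ => θ) N (Φ N)) := by
            refine integral_congr_ae (ae_of_all _ fun z => ?_)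
            unfold enskogRate
            exact integral_congr_ae (ae_of_all _ fun x₀ => by simp only [hψ]; ring)
        _ = _ := hswap
        _ = _ := integral_congr_ae (ae_of_all _ fun x₀ => integral_const_mul _ _)
    · haveI : OpensMeasurableSpace (Config (N + 1) (Fin 3) T3 × T3) := Prod.opensMeasurableSpace
      have h1 : Measurable fun q : Config (N + 1) (Fin 3) T3 × T3 => χ (t, q.2) :=
        (hχ.comp (continuous_const.prodMk continuous_snd)).measurable
      refine Integrable.mono' (integrable_const (Cχ * (K * Bb))) (h1.mul (hf2 N)).aestronglyMeasurable
        (ae_of_all _ fun q => ?_)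
      rw [Real.norm_eq_abs]
      dsimp only [Function.uncurry]
      rw [abs_mul]
      exact mul_le_mul (hCχ q.2) (hfb N q.1 q.2) (abs_nonneg _) hCχ0
  -- STEP 4: dominated convergence over the torus
  have hmain : Tendsto (fun N : ℕ => ∫ x₀, χ (t, x₀) *
      ∫ z, ψ (σ ^ 3 * mollDensity r z x₀) * pairFunctional r Ξ z x₀
        ∂(localGibbsLaw σ (fun _ => a) (fun _ => u) (fun _ => θ) N (Φ N))) atTop
      (𝓝 (∫ x₀, χ (t, x₀) * ((∫ p, sphereMark Ξ p.1 p.2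
        ∂((gaussMeasure u θ).prod (gaussMeasure u θ))) * ψ (σ ^ 3)))) := by
    refine tendsto_integral_of_dominated_convergence (fun _ => Cχ * (K * Bb)) (fun N => ?_)
      (integrable_const _) (fun N => ae_of_all _ fun x₀ => ?_) (ae_of_all _ fun x₀ => (hlim x₀).const_mul _)
    · have hJm : StronglyMeasurable fun x₀ : T3 => ∫ z, ψ (σ ^ 3 * mollDensity r z x₀) *
          pairFunctional r Ξ z x₀
          ∂(localGibbsLaw σ (fun _ => a) (fun _ => u) (fun _ => θ) N (Φ N)) :=
        (hf2 N).stronglyMeasurable.integral_prod_left'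
      exact ((hχ.comp (continuous_const.prodMk continuous_id)).measurable.mul hJm.measurable).aestronglyMeasurable
    · have hJb : |∫ z, ψ (σ ^ 3 * mollDensity r z x₀) * pairFunctional r Ξ z x₀
          ∂(localGibbsLaw σ (fun _ => a) (fun _ => u) (fun _ => θ) N (Φ N))| ≤ K * Bb := by
        have h := norm_integral_le_of_norm_le_const
          (μ := localGibbsLaw σ (fun _ => a) (fun _ => u) (fun _ => θ) N (Φ N))
          (f := fun z => ψ (σ ^ 3 * mollDensity r z x₀) * pairFunctional r Ξ z x₀)
          (C := K * Bb) (ae_of_all _ fun z => by rw [Real.norm_eq_abs]; exact hfb N z x₀)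
        simpa only [Real.norm_eq_abs, probReal_univ, mul_one] using h
      rw [Real.norm_eq_abs, abs_mul]
      exact mul_le_mul (hCχ x₀) hJb (abs_nonneg _) hCχ0
  -- conclusion
  have hval : ∫ x₀, χ (t, x₀) * ((∫ p, sphereMark Ξ p.1 p.2
      ∂((gaussMeasure u θ).prod (gaussMeasure u θ))) * ψ (σ ^ 3)) =
      (∫ x : UnitAddTorus (Fin 3), χ (t, x)) * g (σ ^ 3) * contactValue (σ ^ 3) *
        ∫ p : V3 × V3, sphereMark Ξ p.1 p.2 *
          (localMaxwellian 1 θ u p.1 * localMaxwellian 1 θ u p.2) := by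
    rw [integral_mul_const, integral_prod_gaussMeasure hθ u]
    simp only [hψ]
    ring
  rw [hval] at hmain
  exact hmain.congr fun N => (hE N).symm


end Literature.MathematicalPhysics.KineticTheory

end
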